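import Literature.NumberTheory.DiophantineGeometry.GenEllProjLine
import Literature.NumberTheory.DiophantineGeometry.GenEllBDClasses
import Mathlib.NumberTheory.NumberField.ProductFormula
import HarnessLib

/-!
# [GenEll] §1 on `ℙ¹`: the conductor of a point with respect to an arbitrary divisor, and Prop. 1.6

S. Mochizuki, *Arithmetic elliptic curves in general position*, Math. J. Okayama Univ. 52 (2010)
[cite: MochizukiGenEll2010] (kurims manuscript, Feb. 2009), read on the page: Def. 1.5 (iv) p. 8
(the conductor `log-cond_D(x) := deg_F((D_x)_red)` of a point `x ∈ U_X(F)` w.r.t. an effective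
Cartier divisor `D ⊆ X`), Prop. 1.6 p. 9 ("`log-cond_D ≲ ht_D` on `U(Q̄)`", `ht_D := ht_{𝒪_X(D)}`),
Remark 1.5.1 p. 8–9.

The tree's `GenEllProjLine` types these for the ONE divisor `C = [0]+[1]+[∞]` of `X = ℙ¹`. The
proofs of [GenEll] Prop. 1.7 / Thm. 2.1 need the conductor w.r.t. OTHER divisors of `ℙ¹` (reduced
inverse images `φ⁻¹(C)_red`); this file types it for an ARBITRARY effective divisor of `ℙ¹_ℤ` and
PROVES Prop. 1.6 for it. ENCODING (faithful for `X = ℙ¹`): an effective divisor `D ⊆ ℙ¹_ℤ` flat over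
`ℤ` is `V(M)` for a binary form `M ∈ ℤ[T₀,T₁]`, recorded (`P1Divisor`) by `m(t) = M(t,1) ∈ ℤ[t]` and
`N = deg M ≥ deg m` (`∞ ∈ supp D` iff `deg m < N`; `deg D = N`); a point `y = (x:1)` meets `D` at a
prime `w` (`w ∈ supp (D_y)_red`) iff `ord_w M(y₀,y₁) > 0` in `w`-primitive coordinates, i.e. iff
`|m(x)|_w < max(|x|_w, 1)^N` (`NFPoint.condSupportDiv`; no coordinates chosen). For `D = C`
(`m = t² − t`, `N = 3`) this IS the tree's `condSupport` (`condSupportDiv_cusps`).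

* `NFPoint.condSupportDiv`, `NFPoint.logCondDiv` — Def. 1.5 (iv) for `(ℙ¹_ℤ, V(M))`;
  `condSupportDiv_cusps`/`logCondDiv_cusps` — agreement with `GenEllProjLine`;
  `condSupportDiv_finite`;
* `NFPoint.finprod_condSupportDiv_le` — `∏_{w ∈ supp} N(w) ≤ ‖m‖₁^{[F:ℚ]} · H_F(x)^N` (product
  formula: `N(w)^{[w ∈ supp]} ≤ max(|x|_w,1)^N / |m(x)|_w` at each finite `w`, and
  `∏_w |m(x)|_w⁻¹ = |N_{F/ℚ}(m(x))| ≤ ‖m‖₁^{[F:ℚ]} ∏_{v∣∞} max(|x|_v,1)^{N·mult v}`);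
* `NFPoint.logCondDiv_le` — **Prop. 1.6 for `(ℙ¹, D)`**: `log-cond_D(x) ≤ N · ht(x) + log ‖m‖₁`
  (`ht_D = ht_{𝒪(N)} ≈ N·ht_{𝒪(1)}`, Prop. 1.4 (i), (iii)); BD-class form `bdLe_logCondDiv`.

`TODO(general form)`: arbitrary arithmetic surfaces (Def. 1.1). Rmk. 1.5.1 (the BD-class of
`log-cond_D` depends only on `(X_ℚ, D_ℚ)`; for `ℙ¹`: forms with the same zero locus over `ℚ` give
supports differing above finitely many rational primes) is recorded here, not typed.
-/

noncomputable section

open NumberField IsDedekindDomain Height Polynomial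

namespace Literature.NumberTheory.DiophantineGeometry.GenEll

/-- An effective divisor `D = V(M) ⊆ ℙ¹_ℤ` given by a binary form `M ∈ ℤ[T₀,T₁]` of degree `deg`,
recorded by its dehomogenisation `poly = M(t,1)` (so `poly.natDegree ≤ deg`; the point `∞` lies on
`D` iff `poly.natDegree < deg`). [cite: MochizukiGenEll2010, Def 1.5 (iv) p.8] -/
structure P1Divisor where
  /-- the dehomogenised form `m(t) = M(t, 1)` -/
  poly : ℤ[X]
  /-- the degree `N` of the form `M` (`= deg D`) -/
  deg : ℕ
  /-- `deg m ≤ N` -/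
  natDegree_le : poly.natDegree ≤ deg

namespace P1Divisor

/-- The divisor `C = [0] + [1] + [∞]`: `M = T₀ T₁ (T₀ − T₁)`, `m = t² − t`, `N = 3`.
[cite: MochizukiGenEll2010, Thm 2.1 (ii) p.11] -/
def cusps : P1Divisor where
  poly := X ^ 2 - X
  deg := 3
  natDegree_le := (natDegree_sub_le _ _).trans (by
    rw [natDegree_X_pow, natDegree_X]; norm_num)

/-- `‖m‖₁ = Σ_i |m_i|`, the sum of the absolute values of the coefficients (the constant of
Prop. 1.6 for `(ℙ¹, D)` is `log ‖m‖₁`). [folklore] -/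
def coeffSum (D : P1Divisor) : ℝ := ∑ i ∈ Finset.range (D.deg + 1), |(D.poly.coeff i : ℝ)|

/-- `‖m‖₁ ≥ 1` when `m ≠ 0` (some coefficient is a nonzero integer). [folklore] -/
private theorem one_le_coeffSum (D : P1Divisor) (h : D.poly ≠ 0) : 1 ≤ D.coeffSum := by
  have hmem : D.poly.natDegree ∈ Finset.range (D.deg + 1) :=
    Finset.mem_range.mpr (Nat.lt_succ_of_le D.natDegree_le)
  have hlead : (1 : ℝ) ≤ |(D.poly.coeff D.poly.natDegree : ℝ)| := by
    have h0 : D.poly.coeff D.poly.natDegree ≠ 0 := leadingCoeff_ne_zero.mpr h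
    rw [← Int.cast_abs]
    exact_mod_cast Int.one_le_abs h0
  exact hlead.trans (Finset.single_le_sum (fun i _ => abs_nonneg ((D.poly.coeff i : ℝ))) hmem)

end P1Divisor

namespace NFPoint

variable (D : P1Divisor)

/-- The support of the conductor `(D_y)_red` of the point `y = (x : 1) ∈ X(F)` w.r.t. `D = V(M)`:
the primes `w` of `F` with `ord_w M(y₀, y₁) > 0` for `w`-primitive coordinates `(y₀ : y₁)` of `y`,
i.e. `|m(x)|_w < max(|x|_w, 1)^N` (multiplicative valuations).
[cite: MochizukiGenEll2010, Def 1.5 (iv) p.8] -/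
def condSupportDiv (P : NFPoint) : Set (HeightOneSpectrum (𝓞 P.F)) :=
  {w | w.valuation P.F (aeval P.x D.poly) < max (w.valuation P.F P.x) 1 ^ D.deg}

/-- The log-conductor `log-cond_D(y) := deg_F((D_y)_red) = (1/[F:ℚ]) · log ∏_{w ∈ supp} N(w)` of a
point of `ℙ¹` w.r.t. `D = V(M)`. [cite: MochizukiGenEll2010, Def 1.5 (iv) p.8] -/
def logCondDiv (P : NFPoint) : ℝ :=
  (P.degree : ℝ)⁻¹ * Real.log ((∏ᶠ w ∈ P.condSupportDiv D, Ideal.absNorm w.asIdeal : ℕ) : ℝ)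

/-- The point lies off the support of `D` (`y ∈ U = X ∖ D`): `m(x) ≠ 0` (and `y ≠ ∞` by
construction). [cite: MochizukiGenEll2010, Def 1.5 (iv) p.8] -/
def OffDiv (P : NFPoint) : Prop := aeval P.x D.poly ≠ 0

variable {D}

/-- For `D = C = [0]+[1]+[∞]` the support is the tree's `condSupport`: `|x(x−1)|_w < max(|x|_w,1)³`
iff `|x|_w < 1`, `|x|_w > 1` or `|x − 1|_w < 1`. [cite: MochizukiGenEll2010, Def 1.5 (iv) p.8] -/
theorem condSupportDiv_cusps (P : NFPoint) : P.condSupportDiv P1Divisor.cusps = P.condSupport := by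
  ext w
  simp only [condSupportDiv, condSupport, P1Divisor.cusps, Set.mem_setOf_eq, map_sub, map_pow,
    aeval_X]
  have hfac : P.x ^ 2 - P.x = P.x * (P.x - 1) := by ring
  rw [hfac, map_mul]
  set v := w.valuation P.F with hv
  rcases lt_trichotomy (v P.x) 1 with hlt | heq | hgt
  · -- `|x| < 1`: then `|x − 1| = 1` and `|x(x−1)| = |x| < 1 = max^3`
    have h1 : v (P.x - 1) = 1 := by
      rw [sub_eq_add_neg, add_comm, Valuation.map_add_eq_of_lt_left v
        (by rwa [Valuation.map_neg, Valuation.map_one]), Valuation.map_neg, Valuation.map_one]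
    rw [h1, mul_one, max_eq_right hlt.le, one_pow]
    exact ⟨fun _ => Or.inl hlt, fun _ => hlt⟩
  · -- `|x| = 1`: `|x(x−1)| = |x−1| ≤ 1`, support iff `|x − 1| < 1`
    rw [heq, one_mul, max_self, one_pow]
    exact ⟨fun h => Or.inr (Or.inr h), fun h => h.elim (fun h => absurd h (lt_irrefl _))
      fun h => h.elim (fun h => absurd h (lt_irrefl _)) id⟩
  · -- `|x| > 1`: `|x − 1| = |x|`, `|x(x−1)| = |x|² < |x|³`
    have h1 : v (P.x - 1) = v P.x := by
      rw [sub_eq_add_neg]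
      exact Valuation.map_add_eq_of_lt_left v (by rwa [Valuation.map_neg, Valuation.map_one])
    rw [h1, max_eq_left hgt.le]
    refine ⟨fun _ => Or.inr (Or.inl hgt), fun _ => ?_⟩
    calc v P.x * v P.x = v P.x ^ 2 := (sq _).symm
      _ < v P.x ^ 3 := pow_lt_pow_right₀ hgt (by norm_num)

/-- Hence the two log-conductors agree at `C`. [cite: MochizukiGenEll2010, Def 1.5 (iv) p.8] -/
theorem logCondDiv_cusps (P : NFPoint) : P.logCondDiv P1Divisor.cusps = P.logCond := by
  rw [logCondDiv, logCond, condSupportDiv_cusps]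

/-- The support of the conductor w.r.t. `D` is contained in the zeros of `m(x)` together with the
poles of `x`. [cite: MochizukiGenEll2010, Def 1.5 (iv) p.8] -/
theorem condSupportDiv_subset (P : NFPoint) :
    P.condSupportDiv D ⊆ {w | w.valuation P.F (aeval P.x D.poly) < 1} ∪
      {w | 1 < w.valuation P.F P.x} := by
  intro w hw
  simp only [condSupportDiv, Set.mem_setOf_eq] at hw
  by_cases hx : w.valuation P.F P.x ≤ 1
  · left
    rw [max_eq_right hx, one_pow] at hw
    exact hw
  · right; exact not_le.mp hx

/-- Off `D` the support of the conductor is finite. [cite: MochizukiGenEll2010, Def 1.5 (iv) p.8] -/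
theorem condSupportDiv_finite (P : NFPoint) (hP : P.OffDiv D) : (P.condSupportDiv D).Finite := by
  have h0 : {w : HeightOneSpectrum (𝓞 P.F) | w.valuation P.F (aeval P.x D.poly) < 1} ⊆
      HeightOneSpectrum.Support (𝓞 P.F) (aeval P.x D.poly)⁻¹ := by
    intro v hv
    simp only [HeightOneSpectrum.Support, Set.mem_setOf_eq, map_inv₀] at hv ⊢
    exact (one_lt_inv₀ (zero_lt_iff.mpr ((Valuation.ne_zero_iff _).mpr hP))).mpr hv
  exact (((HeightOneSpectrum.Support.finite (𝓞 P.F) _).subset h0).union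
    (HeightOneSpectrum.Support.finite (𝓞 P.F) P.x)).subset P.condSupportDiv_subset

end NFPoint

section Places

variable {F : Type*} [Field F] [NumberField F]

/-- At a finite place, a value `> 1` is at least `N(v)` (the value group of `|·|_v` is `N(v)^ℤ`).
[folklore] -/
private theorem absNorm_le_of_one_lt_valuation (v : HeightOneSpectrum (𝓞 F)) {y : F}
    (hy : 1 < v.valuation F y) : (Ideal.absNorm v.asIdeal : ℝ) ≤ FinitePlace.mk v y := by
  -- adapted from `GenEllConductorHeight` (abc-iut-S-d1), where it is private
  have hy0 : v.valuation F y ≠ 0 := ne_zero_of_lt hy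
  rw [FinitePlace.mk_apply, FinitePlace.norm_embedding']
  obtain ⟨u, hu⟩ : ∃ u : Multiplicative ℤ, (u : WithZero (Multiplicative ℤ)) = v.valuation F y :=
    ⟨WithZero.unzero hy0, WithZero.coe_unzero hy0⟩
  have hu1 : 1 < u := by rw [← WithZero.coe_lt_coe, hu, WithZero.coe_one]; exact hy
  have hn : 1 ≤ Multiplicative.toAdd u := by
    have : (0 : ℤ) < Multiplicative.toAdd u := by
      rwa [← Multiplicative.ofAdd_lt, ofAdd_toAdd, ofAdd_zero]
    omega
  rw [← hu, WithZeroMulInt.toNNReal_neg_apply _ WithZero.coe_ne_zero, WithZero.unzero_coe]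
  have := zpow_le_zpow_right₀ (NumberField.HeightOneSpectrum.one_lt_absNorm_nnreal v).le hn
  rw [zpow_one] at this
  exact_mod_cast this

/-- Real form: `1 < |y|_v` implies `N(v) ≤ |y|_v`. [folklore] -/
private theorem absNorm_le_of_one_lt_mk (v : HeightOneSpectrum (𝓞 F)) {y : F}
    (hy : 1 < FinitePlace.mk v y) : (Ideal.absNorm v.asIdeal : ℝ) ≤ FinitePlace.mk v y := by
  refine absNorm_le_of_one_lt_valuation v ?_
  by_contra hle
  push Not at hle
  have hmono := (WithZeroMulInt.toNNReal_strictMono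
    (NumberField.HeightOneSpectrum.one_lt_absNorm_nnreal v)).monotone hle
  rw [map_one] at hmono
  rw [FinitePlace.mk_apply, FinitePlace.norm_embedding'] at hy
  exact absurd hy (not_lt.mpr (by exact_mod_cast hmono))

/-- A finite place is bounded on a sum by any common bound of the summands (ultrametric
inequality). [folklore] -/
private theorem finitePlace_sum_le (w : FinitePlace F) {ι : Type*} (s : Finset ι) (g : ι → F)
    {B : ℝ} (hB : 0 ≤ B) (h : ∀ i ∈ s, w (g i) ≤ B) : w (∑ i ∈ s, g i) ≤ B := by
  classical
  induction s using Finset.induction_on with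
  | empty => simpa using hB
  | insert a s ha ih =>
    rw [Finset.sum_insert ha]
    exact (FinitePlace.add_le w _ _).trans (max_le (h a (Finset.mem_insert_self a s))
      (ih fun i hi => h i (Finset.mem_insert_of_mem hi)))

/-- A finite place takes values `≤ 1` on (images of) integers. [folklore] -/
private theorem finitePlace_intCast_le_one (w : FinitePlace F) (c : ℤ) : w (c : F) ≤ 1 := by
  rw [← FinitePlace.mk_maximalIdeal w, FinitePlace.mk_apply,
    show (c : F) = algebraMap (𝓞 F) F (c : 𝓞 F) by rw [map_intCast]]
  exact FinitePlace.norm_le_one F w.maximalIdeal (c : 𝓞 F)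

/-- Nonarchimedean estimate (the "contributions at the nonarchimedean primes" of the printed proof
of Prop. 1.6): for `m ∈ ℤ[t]` of degree `≤ N` and a finite place `w`, `|m(y)|_w ≤ max(|y|_w, 1)^N`.
[cite: MochizukiGenEll2010, Prop 1.6 p.9] -/
theorem finitePlace_aeval_le (w : FinitePlace F) (m : ℤ[X]) {N : ℕ} (hm : m.natDegree ≤ N)
    (y : F) : w (aeval y m) ≤ max (w y) 1 ^ N := by
  rw [aeval_eq_sum_range' (Nat.lt_succ_of_le hm)]
  refine finitePlace_sum_le w _ _ (pow_nonneg (le_max_of_le_right zero_le_one) N) fun i hi => ?_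
  rw [zsmul_eq_mul, map_mul, map_pow]
  calc w (m.coeff i : F) * w y ^ i ≤ 1 * max (w y) 1 ^ i :=
        mul_le_mul (finitePlace_intCast_le_one w _)
          (pow_le_pow_left₀ (apply_nonneg w y) (le_max_left _ _) i) (pow_nonneg (apply_nonneg w y) i)
          zero_le_one
    _ ≤ max (w y) 1 ^ N := by
        rw [one_mul]
        exact pow_le_pow_right₀ (le_max_right _ _) (Nat.le_of_lt_succ (Finset.mem_range.mp hi))

omit [NumberField F] in
/-- Archimedean estimate (the "contributions at the archimedean primes": `|s|` is bounded on the
compact `X^arc`): for an infinite place `v`, `|m(y)|_v ≤ ‖m‖₁ · max(|y|_v, 1)^N`.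
[cite: MochizukiGenEll2010, Prop 1.6 p.9] -/
theorem infinitePlace_aeval_le (v : InfinitePlace F) (D : P1Divisor) (y : F) :
    v (aeval y D.poly) ≤ D.coeffSum * max (v y) 1 ^ D.deg := by
  rw [aeval_eq_sum_range' (Nat.lt_succ_of_le D.natDegree_le), P1Divisor.coeffSum, Finset.sum_mul]
  refine (v.1.sum_le _ _).trans (Finset.sum_le_sum fun i hi => ?_)
  change v ((D.poly.coeff i) • y ^ i) ≤ _
  rw [zsmul_eq_mul, map_mul, map_pow, InfinitePlace.map_intCast, Int.norm_eq_abs]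
  refine mul_le_mul_of_nonneg_left ?_ (abs_nonneg _)
  calc v y ^ i ≤ max (v y) 1 ^ i := pow_le_pow_left₀ (apply_nonneg v y) (le_max_left _ _) i
    _ ≤ max (v y) 1 ^ D.deg :=
        pow_le_pow_right₀ (le_max_right _ _) (Nat.le_of_lt_succ (Finset.mem_range.mp hi))

end Places

namespace NFPoint

variable {D : P1Divisor}

/-- The support condition in terms of the real absolute value `|·|_w = N(w)^{-ord_w}`.
[cite: MochizukiGenEll2010, Def 1.5 (iv) p.8] -/
theorem mem_condSupportDiv_iff_mk (P : NFPoint) (w : HeightOneSpectrum (𝓞 P.F)) :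
    w ∈ P.condSupportDiv D ↔
      FinitePlace.mk w (aeval P.x D.poly) < max (FinitePlace.mk w P.x) 1 ^ D.deg := by
  have hmono := WithZeroMulInt.toNNReal_strictMono
    (NumberField.HeightOneSpectrum.one_lt_absNorm_nnreal w)
  simp only [condSupportDiv, Set.mem_setOf_eq, FinitePlace.mk_apply, FinitePlace.norm_embedding']
  rw [← hmono.lt_iff_lt, map_pow, hmono.monotone.map_max, map_one, ← NNReal.coe_lt_coe]
  push_cast
  exact Iff.rfl

/-- **The radical of the conductor w.r.t. `D` is bounded by `‖m‖₁^{[F:ℚ]} · H_F(x)^{deg D}`**: for a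
point `x ∈ F` off `D = V(M)`, `∏_{w ∈ supp (D_x)_red} N(w) ≤ ‖m‖₁^{[F:ℚ]} · H_F(x)^N`. At each finite
place `N(w)^{[w ∈ supp]} ≤ max(|x|_w,1)^N/|m(x)|_w` (value group), so the left side is at most
`∏_w max(|x|_w,1)^N · ∏_w |m(x)|_w⁻¹`, and `∏_w |m(x)|_w⁻¹ = |N_{F/ℚ}(m(x))| = ∏_{v∣∞} |m(x)|_v
≤ ‖m‖₁^{[F:ℚ]} ∏_{v∣∞} max(|x|_v,1)^N` (product formula). [cite: MochizukiGenEll2010, Prop 1.6 p.9] -/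
theorem finprod_condSupportDiv_le (P : NFPoint) (hP : P.OffDiv D) :
    ((∏ᶠ w ∈ P.condSupportDiv D, Ideal.absNorm w.asIdeal : ℕ) : ℝ) ≤
      D.coeffSum ^ Module.finrank ℚ P.F * mulHeight₁ P.x ^ D.deg := by
  classical
  set a : P.F := aeval P.x D.poly with ha_def
  have ha : a ≠ 0 := hP
  have hfin := P.condSupportDiv_finite hP
  -- the comparison function on finite places and its basic properties
  set R : FinitePlace P.F → ℝ := fun w => max (w P.x) 1 ^ D.deg / w a with hR_def
  have hapos : ∀ w : FinitePlace P.F, 0 < w a := fun w => FinitePlace.pos_iff.mpr ha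
  have hR1 : ∀ w, 1 ≤ R w := fun w => by
    rw [hR_def, le_div_iff₀ (hapos w), one_mul]
    exact finitePlace_aeval_le w D.poly D.natDegree_le P.x
  have hmaxfs : Function.HasFiniteMulSupport fun w : FinitePlace P.F => max (w P.x) 1 := by
    by_cases hx : P.x = 0
    · simp only [hx, map_zero, max_eq_right (zero_le_one' ℝ)]
      exact Function.hasFiniteMulSupport_one
    · exact (FinitePlace.hasFiniteMulSupport hx).max Function.hasFiniteMulSupport_one
  have hRfs : Function.HasFiniteMulSupport R :=
    (hmaxfs.pow D.deg).div (FinitePlace.hasFiniteMulSupport ha)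
  -- at a prime of the support, `N(w) ≤ R w`
  have hRsupp : ∀ v ∈ hfin.toFinset, (Ideal.absNorm v.asIdeal : ℝ) ≤ R (FinitePlace.mk v) := by
    intro v hv
    have hv' := (P.mem_condSupportDiv_iff_mk v).mp (hfin.mem_toFinset.mp hv)
    have hgt : 1 < R (FinitePlace.mk v) := by
      rw [hR_def]; exact (one_lt_div (hapos _)).mpr hv'
    -- `R = max (|x^N / a|, |a⁻¹|)`
    have hRv : R (FinitePlace.mk v) =
        max (FinitePlace.mk v (P.x ^ D.deg / a)) (FinitePlace.mk v a⁻¹) := by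
      simp only [hR_def, map_div₀, map_pow, map_inv₀]
      rw [inv_eq_one_div, max_div_div_right (hapos _).le]
      congr 1
      rcases le_total (FinitePlace.mk v P.x) 1 with h | h
      · rw [max_eq_right h, max_eq_right (pow_le_one₀ (apply_nonneg _ _) h), one_pow]
      · rw [max_eq_left h, max_eq_left (one_le_pow₀ h)]
    rw [hRv] at hgt ⊢
    rcases lt_max_iff.mp hgt with h | h
    · exact (absNorm_le_of_one_lt_mk v h).trans (le_max_left _ _)
    · exact (absNorm_le_of_one_lt_mk v h).trans (le_max_right _ _)
  -- step A: the conductor product is at most `∏ᶠ_w R w`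
  have hA : ((∏ᶠ w ∈ P.condSupportDiv D, Ideal.absNorm w.asIdeal : ℕ) : ℝ) ≤ ∏ᶠ w, R w := by
    rw [finprod_mem_eq_finite_toFinset_prod _ hfin, Nat.cast_prod]
    set B : Finset (FinitePlace P.F) := hfin.toFinset.image FinitePlace.mk with hB
    have hprod : ∏ w ∈ B, R w ≤ ∏ᶠ w, R w := by
      rw [finprod_eq_prod_of_mulSupport_subset R (s := hRfs.toFinset ∪ B) (by
        intro w hw; exact Finset.mem_union_left _ (hRfs.mem_toFinset.mpr hw)),
        ← Finset.prod_sdiff (Finset.subset_union_right : B ⊆ hRfs.toFinset ∪ B)]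
      exact le_mul_of_one_le_left (Finset.prod_nonneg fun w _ => zero_le_one.trans (hR1 w))
        (Finset.one_le_prod fun w _ => hR1 w)
    refine le_trans ?_ hprod
    rw [hB, Finset.prod_image fun v _ v' _ h => FinitePlace.mk_eq_iff.mp h]
    exact Finset.prod_le_prod (fun v _ => Nat.cast_nonneg _) hRsupp
  -- step B: evaluate `∏ᶠ_w R w` by the product formula and bound the archimedean part
  have hB : ∏ᶠ w, R w =
      (∏ᶠ w : FinitePlace P.F, max (w P.x) 1) ^ D.deg * |((Algebra.norm ℚ) a : ℝ)| := by
    have h1 : ∏ᶠ w, R w =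
        (∏ᶠ w : FinitePlace P.F, max (w P.x) 1 ^ D.deg) / ∏ᶠ w : FinitePlace P.F, w a := by
      simp only [hR_def]
      exact finprod_div_distrib (f := fun w : FinitePlace P.F => max (w P.x) 1 ^ D.deg)
        (g := fun w : FinitePlace P.F => w a) (hmaxfs.pow D.deg) (FinitePlace.hasFiniteMulSupport ha)
    rw [h1, ← finprod_pow hmaxfs, FinitePlace.prod_eq_inv_abs_norm ha]
    push_cast
    rw [div_inv_eq_mul]
  have hC : |((Algebra.norm ℚ) a : ℝ)| ≤ D.coeffSum ^ Module.finrank ℚ P.F *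
      (∏ v : InfinitePlace P.F, max (v P.x) 1 ^ v.mult) ^ D.deg := by
    have h' : |((Algebra.norm ℚ) a : ℝ)| = ∏ v : InfinitePlace P.F, v a ^ v.mult := by
      rw [InfinitePlace.prod_eq_abs_norm a, Rat.cast_abs]
    rw [h', ← InfinitePlace.sum_mult_eq, ← Finset.prod_pow_eq_pow_sum, ← Finset.prod_pow,
      ← Finset.prod_mul_distrib]
    refine Finset.prod_le_prod (fun v _ => pow_nonneg (apply_nonneg v a) _) fun v _ => ?_
    rw [← pow_mul, mul_comm (v.mult), pow_mul, ← mul_pow]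
    exact pow_le_pow_left₀ (apply_nonneg v a) (infinitePlace_aeval_le v D P.x) _
  -- assemble with `H_F(x) = (∏_{v∣∞} max(|x|_v,1)^{mult}) · ∏ᶠ_w max(|x|_w,1)`
  have hH : mulHeight₁ P.x = (∏ v : InfinitePlace P.F, max (v P.x) 1 ^ v.mult) *
      ∏ᶠ w : FinitePlace P.F, max (w P.x) 1 := NumberField.mulHeight₁_eq P.x
  have hfin_nonneg : 0 ≤ ∏ᶠ w : FinitePlace P.F, max (w P.x) 1 := finprod_nonneg fun w => by simp
  calc ((∏ᶠ w ∈ P.condSupportDiv D, Ideal.absNorm w.asIdeal : ℕ) : ℝ)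
      ≤ ∏ᶠ w, R w := hA
    _ = (∏ᶠ w : FinitePlace P.F, max (w P.x) 1) ^ D.deg * |((Algebra.norm ℚ) a : ℝ)| := hB
    _ ≤ (∏ᶠ w : FinitePlace P.F, max (w P.x) 1) ^ D.deg * (D.coeffSum ^ Module.finrank ℚ P.F *
          (∏ v : InfinitePlace P.F, max (v P.x) 1 ^ v.mult) ^ D.deg) :=
        mul_le_mul_of_nonneg_left hC (pow_nonneg hfin_nonneg _)
    _ = D.coeffSum ^ Module.finrank ℚ P.F * mulHeight₁ P.x ^ D.deg := by rw [hH]; ring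

/-- **[GenEll] Proposition 1.6 for `X = ℙ¹` and an arbitrary effective divisor `D = V(M)`**
(p. 9: "`log-cond_D ≲ ht_D` on `U(Q̄)`"; here `ht_D = ht_{𝒪(N)} ≈ N · ht` with `N = deg D`, Prop. 1.4
(i), (iii)), in explicit form: for every point off `supp D`, presented over any number field,
`log-cond_D(x) ≤ N · ht(x) + log ‖m‖₁`. `TODO(general form)`: arbitrary arithmetic surfaces.
[cite: MochizukiGenEll2010, Prop 1.6 p.9] -/
theorem logCondDiv_le (P : NFPoint) (hP : P.OffDiv D) :
    P.logCondDiv D ≤ D.deg * P.ht + Real.log D.coeffSum := by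
  classical
  have hfin := P.condSupportDiv_finite hP
  have hd : (0 : ℝ) < P.degree := Nat.cast_pos.mpr P.degree_pos
  have hdeg : (Module.finrank ℚ P.F : ℝ) = P.degree := rfl
  have hpoly : D.poly ≠ 0 := by rintro h; exact hP (by rw [h, map_zero])
  have hS : 1 ≤ D.coeffSum := D.one_le_coeffSum hpoly
  have hN1 : ∀ v : HeightOneSpectrum (𝓞 P.F), 1 ≤ Ideal.absNorm v.asIdeal := fun v =>
    Nat.one_le_iff_ne_zero.mpr (by rw [Ne, Ideal.absNorm_eq_zero_iff]; exact v.ne_bot)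
  have hpos : (0 : ℝ) < ((∏ᶠ w ∈ P.condSupportDiv D, Ideal.absNorm w.asIdeal : ℕ) : ℝ) := by
    rw [finprod_mem_eq_finite_toFinset_prod _ hfin]
    exact_mod_cast Finset.prod_pos fun v _ => hN1 v
  have hH : 0 < mulHeight₁ P.x := mulHeight₁_pos _
  have hlog : Real.log ((∏ᶠ w ∈ P.condSupportDiv D, Ideal.absNorm w.asIdeal : ℕ) : ℝ) ≤
      Module.finrank ℚ P.F * Real.log D.coeffSum + D.deg * logHeight₁ P.x := by
    calc _ ≤ Real.log (D.coeffSum ^ Module.finrank ℚ P.F * mulHeight₁ P.x ^ D.deg) :=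
          Real.log_le_log hpos (P.finprod_condSupportDiv_le hP)
      _ = _ := by
          rw [Real.log_mul (by positivity) (by positivity), Real.log_pow, Real.log_pow]
          rfl
  unfold logCondDiv NFPoint.ht
  rw [hdeg] at hlog
  calc (P.degree : ℝ)⁻¹ * Real.log ((∏ᶠ w ∈ P.condSupportDiv D, Ideal.absNorm w.asIdeal : ℕ) : ℝ)
      ≤ (P.degree : ℝ)⁻¹ * (P.degree * Real.log D.coeffSum + D.deg * logHeight₁ P.x) :=
        mul_le_mul_of_nonneg_left hlog (inv_nonneg.mpr hd.le)
    _ = D.deg * ((P.degree : ℝ)⁻¹ * logHeight₁ P.x) + Real.log D.coeffSum := by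
        field_simp
        ring

/-- **[GenEll] Prop. 1.6 for `(ℙ¹, D)` in BD-class form**: on every set of points off `supp D`,
`log-cond_D ≲ (deg D) · ht` (`BDLe`, Def. 1.2 (ii)). [cite: MochizukiGenEll2010, Prop 1.6 p.9] -/
theorem bdLe_logCondDiv (D : P1Divisor) {S : Set NFPoint} (hS : ∀ P ∈ S, P.OffDiv D) :
    BDLe S (fun P => P.logCondDiv D) (fun P => D.deg * P.ht) :=
  ⟨Real.log D.coeffSum, fun P hP => by linarith [logCondDiv_le P (hS P hP)]⟩

end NFPoint

end Literature.NumberTheory.DiophantineGeometry.GenEll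

end
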